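import Summits.QuantumFields.YangMills.Theorems.LuscherReductionRunningReductionOrbitDist
import Summits.QuantumFields.YangMills.Theorems.LuscherReductionRunningReductionConstLift
import Summits.QuantumFields.YangMills.Theorems.FemtoTransferGapRungW1upLink
import Mathlib.Analysis.Normed.Group.AddCircle
import HarnessLib

/-!
# Torons and the orbit distance: a constant abelian configuration is, up to a centre twist and a gauge transformation, the one with
# REDUCED link angles — so `min_z orbitDist(τ_z V_θ) ≤ (√2/2)·L³·Σ_k ‖2θ_k‖_{ℝ/(2π/L)ℤ}`, and the valley condition
# `∀ z, δ < orbitDist(τ_z V_θ)` forces an adjoint holonomy phase `2θ_k` at distance `> √2δ/(3L³)` from the torons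
# (geometry brick of the VALLEY term, crux `TwistedTraceScaling` stmt-QuantumFields-20203 S-BASE; design note
# `pub/ym-fleet/ym-luscher-20007-p1/COARSE-DESIGN.md` §12 (iii))

`V_θ` = the constant abelian configuration `e ↦ diag(e^{iθ_k}, e^{−iθ_k})` (`k` = direction of `e`).  The ALMOST-PERIODIC abelian gauge transformation
`g_x = diagSU2(Σ_j (n_jπ/L)·ŵ(x_j))` (`ŵ(y) ∈ {1,…,L}` the staircase representative of `y ∈ ℤ/L`) telescopes along every link to the angle shift
`−n_kπ/L`, except through the plane `x_k = 0` where the staircase jumps by `L` and produces the CENTRE element `diagSU2(n_kπ) = (−1)^{n_k}`: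
`g · V_θ = τ_z V_{θ − nπ/L}` (`gaugeTransform_stairGauge_abelianCfg`).  Hence (`orbitDist_twist3_abelianCfg_eq`) `orbitDist(τ_z V_θ) = orbitDist(V_{θ−nπ/L})
≤ √2·L³·Σ_k|θ_k − n_kπ/L|`, i.e. ★ `exists_orbitDist_twist3_abelianCfg_le_norm`: some twist of `V_θ` is within `(√2/2)L³Σ_k‖(2θ_k : AddCircle(2π/L))‖` of the
vacuum orbit, and ★★ `exists_norm_gt_of_valley`: if every twisted orbit distance of `V_θ` exceeds `δ`, some adjoint phase satisfies
`‖(2θ_k : AddCircle(2π/L))‖ > √2δ/(3L³)` — the input that turns the valley condition into the zero-point GAIN of `…ToronGain`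
(`toronZPE_zero_add_slope_mul_norm_le`).

HONEST FRAMING: lattice gauge algebra at fixed `L` (torons = centre-twisted pure gauges); femto rung R2b1 (brick for a stub of a child of a CONDITIONAL route);
not a gap, not Clay.
-/

set_option autoImplicit false

noncomputable section

open Finset
open scoped Matrix ComplexConjugate BigOperators Matrix.Norms.Frobenius
open Literature.MathematicalPhysics.QuantumFieldTheory
open Literature.MathematicalPhysics.QuantumLattice

namespace Summit.QuantumFields.YangMills.Theorems.FemtoTransferGap.TwoLattice.Toron

open Summit.QuantumFields.YangMills.Theorems.FemtoTransferGap

/-! ## §1 The diagonal one-parameter subgroup `diagSU2` -/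

/-- The matrix of `diagSU2 θ`. [folklore] -/
theorem coe_diagSU2 (θ : ℝ) :
    ((diagSU2 θ : SU2) : Matrix (Fin 2) (Fin 2) ℂ) = !![Complex.exp (θ * Complex.I), 0; 0, Complex.exp (-(θ * Complex.I))] := rfl

/-- `diagSU2 (a + b) = diagSU2 a · diagSU2 b`. [folklore] -/
theorem diagSU2_add (a b : ℝ) : diagSU2 (a + b) = diagSU2 a * diagSU2 b := by
  apply Subtype.ext
  rw [Submonoid.coe_mul, coe_diagSU2, coe_diagSU2, coe_diagSU2]
  have h1 : Complex.exp (((a : ℂ) + b) * Complex.I) = Complex.exp (a * Complex.I) * Complex.exp (b * Complex.I) := by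
    rw [← Complex.exp_add]; congr 1; ring
  have h2 : Complex.exp (-(((a : ℂ) + b) * Complex.I)) = Complex.exp (-(a * Complex.I)) * Complex.exp (-(b * Complex.I)) := by
    rw [← Complex.exp_add]; congr 1; ring
  ext i j
  fin_cases i <;> fin_cases j <;> simp [Matrix.mul_apply, Fin.sum_univ_two, h1, h2]

/-- `diagSU2 0 = 1`. [folklore] -/
theorem diagSU2_zero : diagSU2 0 = 1 := by
  apply Subtype.ext
  rw [coe_diagSU2]
  ext i j
  fin_cases i <;> fin_cases j <;> simp

/-- `diagSU2 (−a) = (diagSU2 a)⁻¹`. [folklore] -/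
theorem diagSU2_neg (a : ℝ) : diagSU2 (-a) = (diagSU2 a)⁻¹ := by
  have h : diagSU2 a * diagSU2 (-a) = 1 := by rw [← diagSU2_add, add_neg_cancel, diagSU2_zero]
  exact (inv_eq_of_mul_eq_one_right h).symm

/-- `diagSU2 π = −1`. [folklore] -/
theorem diagSU2_pi : diagSU2 Real.pi = negOne := by
  apply Subtype.ext
  rw [coe_diagSU2, coe_negOne]
  ext i j
  fin_cases i <;> fin_cases j <;> simp [Complex.exp_neg, Complex.exp_pi_mul_I]

/-- `diagSU2 (nπ)` is a centre element: `∃ b, diagSU2 (nπ) = centreElem b` (`b` = parity of `n`). [folklore] -/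
theorem exists_diagSU2_int_mul_pi_eq_centreElem (n : ℤ) : ∃ b : Bool, diagSU2 (n * Real.pi) = TT.centreElem b := by
  induction n using Int.induction_on with
  | zero => exact ⟨false, by simp [TT.centreElem, diagSU2_zero]⟩
  | succ n ih =>
    obtain ⟨b, hb⟩ := ih
    refine ⟨xor b true, ?_⟩
    rw [← TT.centreElem_mul, ← hb, show TT.centreElem true = negOne by rfl, ← diagSU2_pi, ← diagSU2_add]
    push_cast; ring_nf
  | pred n ih =>
    obtain ⟨b, hb⟩ := ih
    refine ⟨xor b true, ?_⟩
    have hneg : diagSU2 (-Real.pi) = negOne := by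
      rw [diagSU2_neg, diagSU2_pi]
      exact inv_eq_of_mul_eq_one_right negOne_mul_negOne
    rw [← TT.centreElem_mul, ← hb, show TT.centreElem true = negOne by rfl, ← hneg, ← diagSU2_add]
    push_cast; ring_nf

/-- `‖diagSU2 θ − 1‖_F ≤ √2·|θ|`. [folklore] -/
theorem frobNorm_diagSU2_sub_one_le (θ : ℝ) :
    frobNorm (((diagSU2 θ : SU2) : Matrix (Fin 2) (Fin 2) ℂ) - 1) ≤ Real.sqrt 2 * |θ| := by
  have h := frobNorm_diagSU2_sub_one_sq θ
  have hc := Real.one_sub_sq_div_two_le_cos (x := θ)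
  have hsq : frobNorm (((diagSU2 θ : SU2) : Matrix (Fin 2) (Fin 2) ℂ) - 1) ^ 2 ≤ (Real.sqrt 2 * |θ|) ^ 2 := by
    rw [h, mul_pow, Real.sq_sqrt (by norm_num), sq_abs]; linarith
  exact (pow_le_pow_iff_left₀ (frobNorm_nonneg _) (by positivity) two_ne_zero).mp hsq

/-! ## §2 The constant abelian configurations and the staircase gauge transformation -/

/-- **Constant abelian configuration** with link angles `θ`: `V_θ(x, k) = diag(e^{iθ_k}, e^{−iθ_k})`.  `θ ∈ (π/L)ℤ³` are the TORONS (centre-twisted pure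
gauges). [cite: Luscher1983, §2] [cite: tHooft1979] -/
def abelianCfg (L : ℕ) (θ : Fin 3 → ℝ) : GaugeConfig 3 L SU2 := fun e => diagSU2 (θ e.2)

/-- Staircase representative `ŵ(y) = val(y − 1) + 1 ∈ {1, …, L}` of `y ∈ ℤ/L`. [folklore] -/
def stair {L : ℕ} [NeZero L] (y : ZMod L) : ℕ := (y - 1).val + 1

/-- The staircase jumps by `1`, except from `y = 0` where it jumps by `1 − L`. [folklore] -/
theorem stair_add_one {L : ℕ} [NeZero L] (y : ZMod L) :
    ((stair (y + 1) : ℕ) : ℝ) - (stair y : ℕ) = 1 - (if y = 0 then (L : ℝ) else 0) := by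
  unfold stair
  rw [add_sub_cancel_right]
  by_cases hy : y = 0
  · rw [if_pos hy, hy, ZMod.val_zero, zero_sub]
    have h := zmod_val_neg_one_add_one L
    have h' : (((-1 : ZMod L).val : ℕ) : ℝ) + 1 = L := by exact_mod_cast h
    push_cast; linarith
  · rw [if_neg hy]
    have hne : y - 1 ≠ -1 := fun h => hy (by
      have h' := congrArg (· + 1) h
      simp only [sub_add_cancel, neg_add_cancel] at h'
      exact h')
    have h := zmod_val_add_one_of_ne hne
    rw [sub_add_cancel] at h
    rw [h]; push_cast; ring

/-- The phase of the staircase gauge transformation: `φ(x) = Σ_j (n_jπ/L)·ŵ(x_j)`. [folklore] -/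
def stairPhase {L : ℕ} [NeZero L] (n : Fin 3 → ℤ) (x : Site 3 L) : ℝ := ∑ j, (n j * Real.pi / L) * (stair (x j) : ℕ)

/-- **The almost-periodic abelian gauge transformation** `g_x = diagSU2(φ(x))`. [cite: tHooft1979] -/
def stairGauge {L : ℕ} [NeZero L] (n : Fin 3 → ℤ) (x : Site 3 L) : SU2 := diagSU2 (stairPhase n x)

/-- Telescoping of the phase along the link `(x, k)`: `φ(x + e_k) − φ(x) = n_kπ/L − [x_k = 0]·n_kπ`. [folklore] -/
theorem stairPhase_shift_sub {L : ℕ} [NeZero L] (n : Fin 3 → ℤ) (x : Site 3 L) (k : Fin 3) :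
    stairPhase n (x.shift k) - stairPhase n x = n k * Real.pi / L - (if x k = 0 then (n k : ℝ) * Real.pi else 0) := by
  unfold stairPhase
  rw [← sum_sub_distrib, Finset.sum_eq_single k]
  · have hs : (x.shift k) k = x k + 1 := by simp [Site.shift]
    rw [hs, ← mul_sub, stair_add_one]
    have hL : (L : ℝ) ≠ 0 := by exact_mod_cast NeZero.ne L
    split_ifs
    · rw [mul_sub, mul_one, div_mul_cancel₀ _ hL]
    · rw [sub_zero, mul_one, sub_zero]
  · intro j _ hj
    have hs : (x.shift k) j = x j := by simp [Site.shift, Pi.single_eq_of_ne hj]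
    rw [hs, sub_self]
  · intro h; exact absurd (mem_univ k) h

/-- ★ **Gauge ∘ twist identity**: with `z_k` the parity bit of `n_k` (`diagSU2(n_kπ) = centreElem z_k`),
`g · V_θ = τ_z V_{θ − nπ/L}` for the staircase gauge transformation `g`. [cite: tHooft1979] [cite: Luscher1983, §2] -/
theorem gaugeTransform_stairGauge_abelianCfg {L : ℕ} [NeZero L] (θ : Fin 3 → ℝ) (n : Fin 3 → ℤ) (z : Fin 3 → Bool)
    (hz : ∀ k, diagSU2 (n k * Real.pi) = TT.centreElem (z k)) :
    gaugeTransform (stairGauge n) (abelianCfg L θ) = TT.twist3 z (abelianCfg L fun k => θ k - n k * Real.pi / L) := by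
  funext e
  obtain ⟨x, k⟩ := e
  rw [TT.twist3_apply]
  simp only [gaugeTransform, abelianCfg, stairGauge]
  rw [← diagSU2_neg, ← diagSU2_add, ← diagSU2_add]
  have hφ := stairPhase_shift_sub n x k
  by_cases hx : x k = 0
  · rw [if_pos hx] at hφ
    rw [if_pos hx, ← hz k, ← diagSU2_add]
    congr 1; linarith
  · rw [if_neg hx] at hφ
    rw [if_neg hx, one_mul]
    congr 1; linarith

/-! ## §3 Orbit distances of the twisted constant abelian configurations -/

/-- ★ **Twisting = reducing the angles**: `orbitDist(τ_z V_θ) = orbitDist(V_{θ − nπ/L})` (`z` the parity bits of `n`). [cite: Luscher1983, §2] -/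
theorem orbitDist_twist3_abelianCfg_eq {L : ℕ} [NeZero L] (θ : Fin 3 → ℝ) (n : Fin 3 → ℤ) (z : Fin 3 → Bool)
    (hz : ∀ k, diagSU2 (n k * Real.pi) = TT.centreElem (z k)) :
    orbitDist (TT.twist3 z (abelianCfg L θ)) = orbitDist (abelianCfg L fun k => θ k - n k * Real.pi / L) := by
  rw [← orbitDist_gaugeTransform (stairGauge n) (TT.twist3 z (abelianCfg L θ)), TT.gaugeTransform_twist3,
    gaugeTransform_stairGauge_abelianCfg θ n z hz, TT.twist3_twist3_self]

/-- `orbitDist(V_θ) ≤ √2·L³·Σ_k |θ_k|` (compare with the vacuum directly). [folklore] -/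
theorem orbitDist_abelianCfg_le {L : ℕ} [NeZero L] (θ : Fin 3 → ℝ) :
    orbitDist (abelianCfg L θ) ≤ Real.sqrt 2 * (L : ℝ) ^ 3 * ∑ k, |θ k| := by
  refine (orbitDist_le 1 (abelianCfg L θ)).trans ?_
  unfold gaugeDist
  have h1 : ∀ e : Edge 3 L, gaugeTransform (1 : Site 3 L → SU2) (abelianCfg L θ) e = diagSU2 (θ e.2) := fun e => by
    simp [gaugeTransform, abelianCfg]
  simp_rw [h1]
  calc ∑ e : Edge 3 L, frobNorm (((diagSU2 (θ e.2) : SU2) : Matrix (Fin 2) (Fin 2) ℂ) - 1)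
      ≤ ∑ e : Edge 3 L, Real.sqrt 2 * |θ e.2| := sum_le_sum fun e _ => frobNorm_diagSU2_sub_one_le _
    _ = Real.sqrt 2 * (L : ℝ) ^ 3 * ∑ k, |θ k| := by
        rw [Fintype.sum_prod_type]
        dsimp only
        rw [sum_const, card_univ, nsmul_eq_mul, ← mul_sum]
        have hc : (Fintype.card (Site 3 L) : ℝ) = (L : ℝ) ^ 3 := by
          rw [Fintype.card_pi, prod_const, card_univ, Fintype.card_fin, ZMod.card]; push_cast; ring
        rw [hc]; ring

/-- ★ For every lattice point `nπ/L`, SOME twist of `V_θ` is within `√2·L³·Σ_k|θ_k − n_kπ/L|` of the vacuum orbit. [cite: Luscher1983, §2] -/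
theorem exists_orbitDist_twist3_abelianCfg_le {L : ℕ} [NeZero L] (θ : Fin 3 → ℝ) (n : Fin 3 → ℤ) :
    ∃ z : Fin 3 → Bool, orbitDist (TT.twist3 z (abelianCfg L θ)) ≤ Real.sqrt 2 * (L : ℝ) ^ 3 * ∑ k, |θ k - n k * Real.pi / L| := by
  choose z hz using fun k => exists_diagSU2_int_mul_pi_eq_centreElem (n k)
  exact ⟨z, (orbitDist_twist3_abelianCfg_eq θ n z hz).le.trans (orbitDist_abelianCfg_le _)⟩

/-- The distance of the ADJOINT phase `2θ` to `(2π/L)ℤ` is twice that of `θ` to the nearest `nπ/L`: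
`‖(2θ : AddCircle (2π/L))‖ = 2|θ − round(Lθ/π)·π/L|`. [folklore] -/
theorem norm_two_mul_eq {L : ℕ} [NeZero L] (θ : ℝ) :
    ‖((2 * θ : ℝ) : AddCircle (2 * Real.pi / L))‖ = 2 * |θ - round ((2 * Real.pi / L)⁻¹ * (2 * θ)) * Real.pi / L| := by
  rw [AddCircle.norm_eq, show (2 : ℝ) = |2| by norm_num, ← abs_mul]
  congr 1
  norm_num
  ring

/-- ★ **AddCircle form**: SOME twist of `V_θ` is within `(√2/2)·L³·Σ_k ‖(2θ_k : AddCircle(2π/L))‖` of the vacuum orbit. [cite: Luscher1983, §2] -/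
theorem exists_orbitDist_twist3_abelianCfg_le_norm {L : ℕ} [NeZero L] (θ : Fin 3 → ℝ) :
    ∃ z : Fin 3 → Bool, orbitDist (TT.twist3 z (abelianCfg L θ)) ≤
      Real.sqrt 2 / 2 * (L : ℝ) ^ 3 * ∑ k, ‖((2 * θ k : ℝ) : AddCircle (2 * Real.pi / L))‖ := by
  set n : Fin 3 → ℤ := fun k => round ((2 * Real.pi / L)⁻¹ * (2 * θ k)) with hn
  obtain ⟨z, hz⟩ := exists_orbitDist_twist3_abelianCfg_le (L := L) θ n
  refine ⟨z, hz.trans (le_of_eq ?_)⟩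
  have hk : ∀ k, ‖((2 * θ k : ℝ) : AddCircle (2 * Real.pi / L))‖ = 2 * |θ k - n k * Real.pi / L| := fun k => by
    rw [norm_two_mul_eq]
  simp_rw [hk]
  rw [← mul_sum]
  ring

/-- ★★ **The valley forces a phase away from the torons**: if every twisted orbit distance of `V_θ` exceeds `δ`, then some adjoint holonomy
phase satisfies `‖(2θ_k : AddCircle (2π/L))‖ > √2·δ/(3L³)`. [cite: Luscher1983, §3] -/
theorem exists_norm_gt_of_valley {L : ℕ} [NeZero L] (θ : Fin 3 → ℝ) {δ : ℝ}
    (h : ∀ z : Fin 3 → Bool, δ < orbitDist (TT.twist3 z (abelianCfg L θ))) :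
    ∃ k : Fin 3, Real.sqrt 2 * δ / (3 * (L : ℝ) ^ 3) < ‖((2 * θ k : ℝ) : AddCircle (2 * Real.pi / L))‖ := by
  obtain ⟨z, hz⟩ := exists_orbitDist_twist3_abelianCfg_le_norm (L := L) θ
  have hδ := (h z).trans_le hz
  by_contra hcon
  push Not at hcon
  have hL1 : (0 : ℝ) < L := by exact_mod_cast Nat.pos_of_ne_zero (NeZero.ne L)
  have hL : (0 : ℝ) < (L : ℝ) ^ 3 := by positivity
  have hsum : ∑ k : Fin 3, ‖((2 * θ k : ℝ) : AddCircle (2 * Real.pi / L))‖ ≤ 3 * (Real.sqrt 2 * δ / (3 * (L : ℝ) ^ 3)) :=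
    (sum_le_sum fun k _ => hcon k).trans (by rw [sum_const, card_univ, Fintype.card_fin]; simp)
  have h2 : Real.sqrt 2 * Real.sqrt 2 = 2 := Real.mul_self_sqrt (by norm_num)
  have hval : Real.sqrt 2 / 2 * (L : ℝ) ^ 3 * (3 * (Real.sqrt 2 * δ / (3 * (L : ℝ) ^ 3))) = δ := by
    have h3 : (L : ℝ) ^ 3 * 3 / (3 * (L : ℝ) ^ 3) = 1 := by
      rw [mul_comm ((L : ℝ) ^ 3) 3]; exact div_self (by positivity)
    calc Real.sqrt 2 / 2 * (L : ℝ) ^ 3 * (3 * (Real.sqrt 2 * δ / (3 * (L : ℝ) ^ 3)))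
        = Real.sqrt 2 * Real.sqrt 2 / 2 * δ * ((L : ℝ) ^ 3 * 3 / (3 * (L : ℝ) ^ 3)) := by ring
      _ = δ := by rw [h2, h3]; ring
  have : δ < δ := by
    calc δ < Real.sqrt 2 / 2 * (L : ℝ) ^ 3 * ∑ k, ‖((2 * θ k : ℝ) : AddCircle (2 * Real.pi / L))‖ := hδ
      _ ≤ Real.sqrt 2 / 2 * (L : ℝ) ^ 3 * (3 * (Real.sqrt 2 * δ / (3 * (L : ℝ) ^ 3))) :=
          mul_le_mul_of_nonneg_left hsum (by positivity)
      _ = δ := hval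
  exact lt_irrefl _ this

end Summit.QuantumFields.YangMills.Theorems.FemtoTransferGap.TwoLattice.Toron

end
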